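import Literature.IUT.LogVolume.AdelicPacketModel
import Literature.NumberTheory.EllipticCurves.PAdicHeightsProofs
import HarnessLib

/-!
# The valuation of the Tate parameter is minus the valuation of the `j`-invariant (Dupuy–Hilado §3.2 /
# Silverman ATAEC Lemma V.5.1) — the modelling choice `ord_v(q_v) := −ord_v(j_E)` of `PilotDivisors` as a
# theorem

Dupuy–Hilado, arXiv:2004.13228 §3.2 (render chunk 8): "for all elliptic curves `A` over a field `L`, a
finite extension of `ℚ_p`, with `|j_A|_L > 1` we have an isomorphism `A(L̄) ≅ E_q(L̄)` where `E_q` is the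
Tate curve for some unique `q ∈ L̄` called the Tate parameter (a geometric invariant which can be written
as a formal power series in `1/j_E` with integer coefficients)". `PilotDivisors` therefore DEFINES
`ord_v(q_v) := −ord_v(j_E)` (`PilotData.ordq`) and never touches Tate uniformisation. This file proves
that the definition agrees with the valuation of an actual Tate parameter: if `q ∈ F_v`
(`v.adicCompletion F`) has `‖q‖ < 1` and Tate `j`-invariant `j(q) = E₄(q)³/Δ(q)` equal to (the image of)
`j_E`, then `‖j_E‖_v = ‖q‖⁻¹` (the tree's `Literature.NumberTheory.EllipticCurves.norm_tateJ_eq`,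
Silverman ATAEC Lemma V.5.1 "`|j(E_q)| = |1/q + 744 + ⋯| = 1/|q|`", fully proved there) and hence
`ord_v(q) = −ord_v(j_E) = PilotData.ordq v` (`ordv_eq_ordq`), with `ord_v` on `F_vˣ` read off `Valued.v`
(`CompletionModel.ordv` of `AdelicPacketModel`). The EXISTENCE of such `q` at a place with
`ord_v(j_E) < 0` is ATAEC Lemma V.5.1's surjectivity half (tree
`Literature.NumberTheory.EllipticCurves.existsUnique_tateJ_eq_of_one_lt_norm`), recorded as `exists_tateParameter`.
[cite: DupuyHilado2025, §3.2–3.3] [cite: SilvermanATAEC1994, Lemma V.5.1]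
Deliberately NOT here: the Tate curve itself / the isomorphism `A(L̄) ≅ E_q(L̄)` (the cell's named FACT
"Tate uniformisation"), anything about Cor. 3.12.
-/

noncomputable section

namespace Literature.IUT.LogVolume

open NumberField IsDedekindDomain Literature.NumberTheory.EllipticCurves

variable (F : Type) [Field F] [NumberField F] (v : HeightOneSpectrum (𝓞 F))

namespace PilotTate

/-- `‖x‖_v = |κ(v)|^{−ord_v(x)}` for the image in `F_v` of `x ∈ F`, `x ≠ 0` (Mathlib's
`FinitePlace.norm_embedding` + `ArakelovDivisors.adicAbv_eq_absNorm_zpow`). [cite: DupuyHilado2025, §2.4.6] -/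
theorem norm_coe_eq_absNorm_zpow {x : F} (hx : x ≠ 0) :
    ‖(x : v.adicCompletion F)‖ = ((Ideal.absNorm v.asIdeal : ℕ) : ℝ) ^ (-ord F v x) := by
  rw [← NumberField.FinitePlace.embedding_apply, NumberField.FinitePlace.norm_embedding,
    adicAbv_eq_absNorm_zpow F v hx]

/-- **`‖j_E‖_v = ‖q‖⁻¹`** for a Tate parameter `q ∈ F_v` of `j_E` (`‖q‖ < 1`, `j(q) = j_E`): Silverman ATAEC
Lemma V.5.1 in the tree (`norm_tateJ_eq`). [cite: SilvermanATAEC1994, Lemma V.5.1] -/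
theorem norm_jE_eq_inv_norm {q : v.adicCompletion F} (hq : ‖q‖ < 1) {jE : F}
    (hj : tateJ q = (jE : v.adicCompletion F)) : ‖(jE : v.adicCompletion F)‖ = ‖q‖⁻¹ := by
  rw [← hj]
  exact norm_tateJ_eq hq

/-- **`ord_v(q) = −ord_v(j_E)`**: the valuation (read off `Valued.v`, `CompletionModel.ordv`) of a Tate
parameter `q ∈ F_vˣ` of `j_E ≠ 0` is minus the valuation of `j_E` — Dupuy–Hilado §3.2's "formal power
series in `1/j_E` with integer coefficients" at the level of valuations. [cite: DupuyHilado2025, §3.2] -/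
theorem ordv_eq_neg_ord (q : (v.adicCompletion F)ˣ) (hq : ‖(q : v.adicCompletion F)‖ < 1) {jE : F}
    (hjE : jE ≠ 0) (hj : tateJ (q : v.adicCompletion F) = (jE : v.adicCompletion F)) :
    CompletionModel.ordv F v q = -ord F v jE := by
  have hN : (1 : ℝ) < ((Ideal.absNorm v.asIdeal : ℕ) : ℝ) := by
    exact_mod_cast NumberField.HeightOneSpectrum.one_lt_absNorm v
  have h := norm_jE_eq_inv_norm F v hq hj
  rw [norm_coe_eq_absNorm_zpow F v hjE, CompletionModel.norm_units, ← zpow_neg, neg_neg] at h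
  have := zpow_right_injective₀ (by positivity) hN.ne' h
  linarith

end PilotTate

/-- **The pilot data's `ord_v(q_v)` IS the valuation of a Tate parameter**: for pilot data `(F, j_E, S, l)`
and a Tate parameter `q ∈ F_vˣ` of `j_E` at any finite place `v` (`‖q‖ < 1`, `j(q) = j_E`),
`PilotData.ordq v = ord_v(q)`. [cite: DupuyHilado2025, §3.2–3.3] -/
theorem PilotData.ordq_eq_ordv (X : PilotData F) (q : (v.adicCompletion F)ˣ)
    (hq : ‖(q : v.adicCompletion F)‖ < 1) (hj : tateJ (q : v.adicCompletion F) = (X.jE : v.adicCompletion F)) :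
    (X.ordq v : ℤ) = CompletionModel.ordv F v q := by
  rw [PilotData.ordq, PilotTate.ordv_eq_neg_ord F v q hq X.jE_ne_zero hj]

/-- **Existence of the Tate parameter at a bad place**: if `ord_v(j_E) < 0` (so `‖j_E‖_v > 1`) there is a
unique `q ∈ F_v`, `q ≠ 0`, with `‖q‖ < 1` and `j(q) = j_E` — ATAEC Lemma V.5.1 (tree
`existsUnique_tateJ_eq_of_one_lt_norm`). [cite: SilvermanATAEC1994, Lemma V.5.1] -/
theorem PilotData.exists_tateParameter (X : PilotData F) {v : HeightOneSpectrum (𝓞 F)} (hv : v ∈ X.S) :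
    ∃! q : v.adicCompletion F, q ≠ 0 ∧ ‖q‖ < 1 ∧ tateJ q = (X.jE : v.adicCompletion F) := by
  apply existsUnique_tateJ_eq_of_one_lt_norm
  have hN : (1 : ℝ) < ((Ideal.absNorm v.asIdeal : ℕ) : ℝ) := by
    exact_mod_cast NumberField.HeightOneSpectrum.one_lt_absNorm v
  rw [PilotTate.norm_coe_eq_absNorm_zpow F v X.jE_ne_zero]
  exact one_lt_zpow₀ hN (by have := X.ord_jE_neg v hv; omega)

end Literature.IUT.LogVolume

end
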